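import Literature.MathematicalPhysics.QuantumFieldTheory.Balaban1983to89.B13Bound226Centred
import Literature.MathematicalPhysics.QuantumFieldTheory.Balaban1983to89.B13Term214CentredPieces

/-!
# `Balaban1983to89.B13Bound226BoxTail` — T. Bałaban, *Renormalization group approach to lattice gauge field theories. II.
Cluster expansions*, Commun. Math. Phys. **116** (1988) 1–22 [Balaban1988RG2Cluster], pp. 15–17, with [Balaban1987RG1]
(2.10)–(2.13) pp. 266–268: the two TAILS and the CENTRE of node N22's (S-vertex-T′), per term of the torus model, ALONG THE
WINDOW-DILATED FAMILY of `B13Term214WindowDilated` — (i) the BOX TAIL `‖(2.14)_b(χ, χᶜ, 𝐕₀) − (2.14)_b(1, 1, 𝐕₀)‖ ≤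
e^{−½κR²}·weight·e^{a₅|Z|}` for a term without large-field boxes (`P = ∅`), from `0 ≤ χχᶜ ≤ 1` and the box law `χχᶜ = 1` on
`⟨B,B⟩ < R²` (print's chain (2.15)–(2.26) run once on the difference, whose last line `−F214(1 − χχᶜ, 1, 𝐕₀)` is a (2.22)-type
last line with the small constant `e^{−½κR²}` in front); (ii) the BOX-FREE CENTRE with field-constant potentials is `b`-FREE on
the ball (radial invariance + holomorphy: `B13Term214CentredPieces.eq_of_radial_invariant`, holomorphy from
`B13Term214WindowDilated.differentiableOn_term214_torus_windowDilated_of_primitives`); (iii) the LARGE-FIELD members (`P ≠ ∅`)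
carry the surplus `e^{−½γ₂(r_P² − r′²)}` in front of the (2.26) weight at the smaller radius `r′` (homogeneity of the last line
in `χ` + `B13Term214WindowDilated.h226_torus_windowDilated_of_primitives` — no new engine)

statement-level skeleton of published theorems with citation tags; proofs where landed; nothing here is a claim about the
Yang–Mills mass gap

PDF held: `paper:balaban1988-cmp116-rg-ii-cluster` (journal page = PDF page + 0), pp. 15–17 (quoted in full in `B13Term214`,
`B13FirstEstimate215`, `B13Replacement223`, `B13Bound226Primitive`, `B13Lemma3TorusPrimitive`); `paper:balaban1987-cmp109-rg-i`
pp. 266–268.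

CITATION HEADER.  [II] p. 16 (2.22) (shape, quoted in `B13Integral223`); p. 15 (2.15), p. 17 (2.26) as quoted in
`B13Bound226Primitive`; [I] p. 266–267 (2.10)–(2.13): the small-field functions are characteristic functions of norms of the
rescaled field `s·B′`, the action is expanded around the critical background.  NOT PRINTED: the three-piece decomposition of
the centred letter; recorded here is that print's own chain prices each piece (lens Cards T23∕T24∕T25).

PROVENANCE.  The road is the memo-only lens seat's Cards T24∕T25 (`run/shared/lean/pub/pub-ymgap/ym-lens-BalabanUVNodes-transfer/
LENS-transfer.md` §19, g13; their X-integral-level and algebraic halves are ported in `B13Term214CentredPieces`); this file types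
the TORUS-LEVEL statements, which the lens does not (bus `run/shared/lean/pub/pub-ymgap/INBOX.md` l.18879∕18889: *«the tails
follow … from `term214_const_mul` + `F214_sub_F214_one` ∕ `F214_chi_const_mul` + YOUR uncentred `h226_torus_windowDilated_of_primitives`»*,
*«its b-freeness on the ball is `term214_windowDilated_const_eq` (radial invariance + your §5 holomorphy at χ := 1)»*).  Cell
`pub-ymgap`, seat `pub-ymgap-dag-n10-c` (g6), node N10 [B13]; consumers: node N22's (S-vertex-T′) two-step centre
(`Summits/…/BalabanUVNodesN22W1RelCentredSectorOfWindowDilated.centred_of_twoStep`, step 2), the unseated N09 successor.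

WHAT IS HERE (no definition).
* §1 `norm_F214_le_of_chi_le_one` (growth of a printed last line with `0 ≤ χχᶜ ≤ 1`), `chi_le_h222_zero_radius` (such `χ`-data
  obey the capstone's (2.22) hypothesis at radius `0`), and THE POINTWISE BOX TAIL FROM THE ENTRYWISE LETTERS, located geometry
  (`norm_core214_boxTail_le_K_of_primitives`): at one `(σ, τ)`, `‖core(F214 χ χᶜ 𝐕₀) − core(F214 1 1 𝐕₀)‖ ≤
  e^{−½κR²}·e^{2η|Λ|}e^{w₀}·e^{αc|Λ|}e^{α(1+2cg)|N|}`, `α = 2θ′ + κ + a₀` — `B13Term214CentredPieces.norm_core214_boxTail_le_223_of_letters`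
  at the replacement letters DERIVED from the located entrywise letters, then `integral223_le`.
* §2 ON THE TORUS ALONG THE FAMILY, `P = ∅` (`h226_torus_windowDilated_boxTail_of_primitives`): for every `b` of the ball
  `|b − 1| < ρ_b`, `‖term(b²A, bΓ, F214 χ χᶜ 𝐕₀) − term(b²A, bΓ, F214 1 1 𝐕₀)‖ ≤ e^{−½κR²}·weight L M c Z a t·e^{a₅|Z|}` from the
  b = 1 letters of `B13Term214WindowDilated` §4 + `K_E` + the primed letters, `0 ≤ χχᶜ ≤ 1` measurable with the box law,
  `𝐕₀` measurable with `Σ|τ||𝐕₀| ≤ ½a₀‖B‖² + w₀` on the per-domain τ-region, `|P| = 0`, and `hvol` with `w₀` at the rate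
  `κ + a₀` — separate holomorphy of both `X`-integrals derived, the Cauchy layer `norm_term214_le_215_polyτ` on the difference,
  `B13Bound226Centred.term214_sub_of_sepHolOnPoly`.
* §3 THE BOX-FREE CENTRE IS b-FREE ON THE TORUS (`term214_torus_windowDilated_boxFree_eq_of_primitives`): with the boxes removed
  and FIELD-CONSTANT potentials `O₀(Y)`, `term(b²A, bΓ, F214 1 1 O₀) = term(A, Γ, F214 1 1 O₀)` for every `b` of the ball
  (`ρ_b < 1`) — radial invariance `term214_dilate_family`, holomorphy from module 41, `eq_of_radial_invariant`.
* §4 THE LARGE-FIELD MEMBERS, `P ≠ ∅` (`h226_torus_windowDilated_largeField_of_primitives`): the data of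
  `h226_torus_windowDilated_of_primitives` verbatim, plus a smaller radius `r′` (`r′² ≤ r_P²`, `|P| ≥ 1`, `hPa : a ≤ γ₂r′²`):
  `‖term(b²A, bΓ, F214 χ χᶜ (b²W + O))‖ ≤ e^{−½γ₂(r_P² − r′²)}·weight L M c Z a t·e^{a₅|Z|}` — the constant pulled out by
  `F214_chi_const_mul` ∕ `core214_const_mul` ∕ `term214_const_mul`, (2.22) at radius `r′` by `h222_rate_split`, then module 41 §4.
HONEST SCOPE.  No estimate new in kind.  The SIZES of the small factors (`R = p(s)∕s` and `κ` for the box tail — `boxTail_rate`;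
the surplus for `P ≠ ∅`), the box law, the measurability and growth of `𝐕₀` and its field-constancy at the centre are the
PRODUCER's data about the datum ([I] (2.9)–(2.13)) — HYPOTHESES here.  Nothing of Bałaban's kernels is constructed;
N10∕N22∕N09 NOT discharged.  No `sorry`, no definition, no new named fact (D-0026).
-/

noncomputable section

namespace Literature.MathematicalPhysics.QuantumFieldTheory.Balaban1983to89.B13Bound226BoxTail

open Matrix MeasureTheory Finset Complex Metric Set
open scoped Real
open B13GaugeDevices (gaussWeight gaussInt gaussNorm gaussMean)
open B13PerturbativeStep (WeightHyp)
open B13Term214 (cquad cgaussWeight cgaussInt cgaussNorm cgaussMean integrand214 core214 F214 term214 SepHolOn)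
open B13Integral223 (integral223 integral223_le norm_F214_le)
open B13FirstEstimate215 (norm_F214_le_printed)
open B13Eq216FirstForm (hdef1_of_linear)
open B13Bound226Primitive (hdef3_of_linear h216R3_of_diff continuous_of_linear)
open B13Bound226Located (h216R1_of_factors hR1_of_entrywise hR2_of_entrywise hR3_of_entrywise h17a_of_entrywise
  h17b_of_entrywise entry_bound_mono_rate kc_l1_nonneg)
open B13CauchyDecay (closedBall_subset_closedBall_of_mem_uIcc two_mul_invTau_eq)
open B13CauchyDecayPoly (SepHolOnPoly norm_term214_le_215_polyτ)
open B13Core214Holomorphic (measurable_F214)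
open B13Core214HolomorphicPrimitive (sepHolOn_core214_sigma_of_primitives)
open B13Bound226LocatedPoly (sepHolOnPoly_core214_tau_of_primitives)
open B13Lemma3TorusPrimitive (weightHyp_tdist1 tdist1_symm kc_tdist1)
open B13Term214WindowDilated (term214_dilate_family smul_entry_le smul_sub_entry_le inv_sq_smul_entry_le
  inv_sq_smul_sub_entry_le sq_smul_sub_entry_le rad_nonneg_of_mem_ball posDef_re_of_form theta_mul_lt_one
  h226_torus_windowDilated_of_primitives differentiableOn_term214_torus_windowDilated_of_primitives)
open B13Bound226Centred (term214_sub_of_sepHolOnPoly)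
open B13Term214CentredPieces (core214_const_mul term214_const_mul F214_chi_const_mul h222_rate_split eq_of_radial_invariant
  norm_core214_boxTail_le_223_of_letters)
open TreeLengthTorus (TPt TDom tsys)
open TreeLengthTorusTransfer (tclosure)
open B13Lemma3TorusData (TBond)
open B13Lemma3TorusTerms (weight Z0)
open B13Bound143 (invTau)
open B5TorusCover (UT)
open B9Thm37GlueTorus (tdist1)

/-! ## §1. Last lines with `0 ≤ χχᶜ ≤ 1`, and the pointwise box tail from the entrywise letters (located geometry) -/

section Pointwise

variable {S : Type*} [DecidableEq S] {ρ : S → S → ℝ} {Kc : ℝ → ℝ}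
variable {Λ : Type} [Fintype Λ] [DecidableEq Λ] {C₀ : Type} [Fintype C₀] [DecidableEq C₀]
variable {D : Type*}

omit [DecidableEq Λ] in
/-- **Growth of a printed last line whose characteristic functions only satisfy `0 ≤ χχᶜ ≤ 1`**: with
`Σ|τ(Y)||𝐕(Y,B)| ≤ ½a₀‖B‖² + w₀`, `‖F214(χ, χᶜ, 𝐕)(B)‖ ≤ e^{w₀}·e^{½(κ + a₀)‖B‖²}` for every `κ ≥ 0` (the rate slack `κ` is
for bookkeeping at a common master rate). [cite: Balaban1988RG2Cluster, (2.20) p.16, (2.22) p.16] (elementary API for (2.14)) -/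
theorem norm_F214_le_of_chi_le_one (cardP : ℕ) {χY₀ χcP : (Λ → ℝ) → ℝ} (Dfam : Finset D) (V : D → (Λ → ℝ) → ℂ)
    (τ : D → ℂ) (B : Λ → ℝ) (hχ0 : 0 ≤ χY₀ B) (hχc0 : 0 ≤ χcP B) (hχ1 : χY₀ B * χcP B ≤ 1) {κ a₀ w₀ : ℝ}
    (hκ : 0 ≤ κ) (h220 : ∑ Y ∈ Dfam, ‖τ Y‖ * ‖V Y B‖ ≤ a₀ / 2 * (B ⬝ᵥ B) + w₀) :
    ‖F214 cardP χY₀ χcP Dfam V τ B‖ ≤ Real.exp w₀ * Real.exp ((κ + a₀) / 2 * (B ⬝ᵥ B)) := by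
  have hBB : 0 ≤ B ⬝ᵥ B := Finset.sum_nonneg fun i _ => mul_self_nonneg (B i)
  refine (norm_F214_le_printed cardP χY₀ χcP Dfam V τ B hχ0 hχc0).trans ?_
  have e1 : Real.exp (∑ Y ∈ Dfam, ‖τ Y‖ * ‖V Y B‖) ≤ Real.exp w₀ * Real.exp ((κ + a₀) / 2 * (B ⬝ᵥ B)) := by
    rw [← Real.exp_add]
    refine Real.exp_le_exp.2 (h220.trans ?_)
    linarith only [mul_nonneg hκ hBB]
  calc χY₀ B * χcP B * Real.exp (∑ Y ∈ Dfam, ‖τ Y‖ * ‖V Y B‖)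
      ≤ 1 * (Real.exp w₀ * Real.exp ((κ + a₀) / 2 * (B ⬝ᵥ B))) := mul_le_mul hχ1 e1 (Real.exp_pos _).le zero_le_one
    _ = _ := one_mul _

omit [DecidableEq Λ] in
/-- Characteristic functions with `χχᶜ ≤ 1` obey the capstone's (2.22) hypothesis AT RADIUS `0` with any rate `κ ≥ 0` and
`q_P(B) := ⟨B,B⟩` (`χχᶜ ≤ 1 ≤ e^{½κ⟨B,B⟩}`). [cite: Balaban1988RG2Cluster, (2.22) p.16] (elementary API for the (2.22) data) -/
theorem chi_le_h222_zero_radius {χY₀ χcP : (Λ → ℝ) → ℝ} (hχ1 : ∀ B, χY₀ B * χcP B ≤ 1) {κ : ℝ} (hκ : 0 ≤ κ) (n : ℕ)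
    (B : Λ → ℝ) : χY₀ B * χcP B ≤ Real.exp (-(κ / 2 * (0 : ℝ) ^ 2 * n) + κ / 2 * (B ⬝ᵥ B)) := by
  have hBB : 0 ≤ B ⬝ᵥ B := Finset.sum_nonneg fun i _ => mul_self_nonneg (B i)
  have e : -(κ / 2 * (0 : ℝ) ^ 2 * n) + κ / 2 * (B ⬝ᵥ B) = κ / 2 * (B ⬝ᵥ B) := by ring
  rw [e]
  exact (hχ1 B).trans (Real.one_le_exp (mul_nonneg (by linarith only [hκ]) hBB))

/-- **THE POINTWISE BOX TAIL FROM THE ENTRYWISE LETTERS** (located geometry; one `(σ, τ)`).  Objects at this `σ`: a complex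
symmetric precision `A′` with `Re A′ ≻ 0`, a LINEAR source `Γ′X = G′·X`, the reference `C ≻ 0`, `Γ₀`; the located letters of
`A′, G′` (`K_G, K_Γ, K_{Cσ}, K₀` at rate `κ_r`, `θ_Γ, θ_C, θ_E`, rates `κ_r > κ_r′ > κ_r″ > 0`, majorant `θ`, `K′θ′ < 1`);
characteristic functions `χ, χᶜ` measurable with `0 ≤ χ`, `0 ≤ χᶜ`, `χχᶜ ≤ 1` and the BOX LAW `χχᶜ = 1` on `⟨B,B⟩ < R²`;
potentials `𝐕₀(Y,·)` measurable with `Σ|τ||𝐕₀| ≤ ½a₀‖B‖² + w₀`; a Gaussian rate `κ ≥ 0` for the box complement and the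
capstone's numeric conditions at `α = 2θ′ + κ + a₀`.  Conclusion: `‖∫dμ₀(X)(lines 2–3)(F214(χ, χᶜ, 𝐕₀)) −
∫dμ₀(X)(lines 2–3)(F214(1, 1, 𝐕₀))‖ ≤ e^{−½κR²}·e^{2η|Λ|}·e^{w₀}·e^{αc|Λ|}·e^{α(1+2cg)|N|}` — the replacement letters
(`R₁`, (2.17) twice, `R₂`, `R₃`) DERIVED from the entrywise letters (`B13Bound226Located`), then
`B13Term214CentredPieces.norm_core214_boxTail_le_223_of_letters` (the centred (2.15) with `ℓ := 0` on the last line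
`−F214(1 − χχᶜ, 1, 𝐕₀)`, its (2.22)-shape by the box law) and `B13Integral223.integral223_le`.
[cite: Balaban1988RG2Cluster, (2.14)–(2.15) p.15, (2.16)–(2.22) p.16, (2.23)–(2.26) p.17; Balaban1987RG1, (2.10)–(2.13) p.266–267] -/
theorem norm_core214_boxTail_le_K_of_primitives (hρ : WeightHyp 0 ρ) (hρs : ∀ x y : S, ρ x y = ρ y x)
    (hKc : ∀ b : ℝ, 0 < b → ∀ (T : Finset S) (x : S), ∑ y ∈ T, Real.exp (-(b * ρ x y)) ≤ Kc b)
    (hKc0 : ∀ b : ℝ, 0 < b → 0 ≤ Kc b)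
    {A : Matrix Λ Λ ℂ} (hAs : A.IsSymm) (hA : (A.map Complex.re).PosDef)
    {Γ : (Λ ⊕ C₀ → ℝ) → (Λ → ℂ)} {G : Matrix Λ (Λ ⊕ C₀) ℂ} (hlin : ∀ X : Λ ⊕ C₀ → ℝ, Γ X = G *ᵥ fun j => (X j : ℂ))
    {C : Matrix Λ Λ ℝ} (hC : C.PosDef) (Γ₀ : Matrix Λ (Λ ⊕ C₀) ℝ)
    -- the last lines at this τ: boxes with the box law, potentials of the centre
    (cardP : ℕ) {χY₀ χcP : (Λ → ℝ) → ℝ} (hχm : Measurable χY₀) (hχcm : Measurable χcP)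
    (hχ0 : ∀ B, 0 ≤ χY₀ B) (hχc0 : ∀ B, 0 ≤ χcP B) (hχ1 : ∀ B, χY₀ B * χcP B ≤ 1) {R κ : ℝ} (hκ : 0 ≤ κ)
    (hbox : ∀ B, B ⬝ᵥ B < R ^ 2 → χY₀ B * χcP B = 1)
    (Dfam : Finset D) {V₀ : D → (Λ → ℝ) → ℂ} (hV₀m : ∀ Y, Measurable (V₀ Y)) (τ : D → ℂ) {a₀ w₀ : ℝ} (ha₀ : 0 ≤ a₀)
    (h220 : ∀ B, ∑ Y ∈ Dfam, ‖τ Y‖ * ‖V₀ Y B‖ ≤ a₀ / 2 * (B ⬝ᵥ B) + w₀)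
    -- located bonds and letters
    (locΛ : Λ → S) (locN : Λ ⊕ C₀ → S) {m : ℕ}
    (hfibΛ : ∀ x : S, (Finset.univ.filter fun i => locΛ i = x).card ≤ m)
    (hfibN : ∀ x : S, (Finset.univ.filter fun j => locN j = x).card ≤ m)
    {kap kap' kap'' θ θE θΓ θC KG KΓ KCs K₀ : ℝ} (hkap'' : 0 < kap'') (hk1 : kap'' < kap') (hk2 : kap' < kap)
    (hθE : 0 ≤ θE) (hθΓ : 0 ≤ θΓ) (hθC : 0 ≤ θC) (hKG : 0 ≤ KG) (hKΓ : 0 ≤ KΓ) (hKCs : 0 ≤ KCs) (hK₀ : 0 ≤ K₀)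
    (hθEle : θE ≤ θ) (hθΓle : θΓ ≤ θ)
    (hθR1le : (m * Kc (kap - kap')) * (m * Kc (kap' - kap''))
      * (θΓ * KCs * KG + KΓ * θC * KG + KΓ * K₀ * θΓ) ≤ θ)
    (hG : ∀ b j, ‖G b j‖ ≤ KG * Real.exp (-(kap * ρ (locΛ b) (locN j))))
    (hΓ₀ : ∀ b j, ‖Γ₀ b j‖ ≤ KΓ * Real.exp (-(kap * ρ (locΛ b) (locN j))))
    (hCs : ∀ b b', ‖A⁻¹ b b'‖ ≤ KCs * Real.exp (-(kap * ρ (locΛ b) (locΛ b'))))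
    (hC216 : ∀ b b', ‖C b b'‖ ≤ K₀ * Real.exp (-(kap * ρ (locΛ b) (locΛ b'))))
    (hdΓ : ∀ b j, ‖(G - Γ₀.map (algebraMap ℝ ℂ)) b j‖ ≤ θΓ * Real.exp (-(kap * ρ (locΛ b) (locN j))))
    (hdC : ∀ b b', ‖(A⁻¹ - C.map (algebraMap ℝ ℂ)) b b'‖ ≤ θC * Real.exp (-(kap * ρ (locΛ b) (locΛ b'))))
    (hdE : ∀ b b', ‖(A - C⁻¹.map (algebraMap ℝ ℂ)) b b'‖ ≤ θE * Real.exp (-(kap * ρ (locΛ b) (locΛ b'))))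
    (hsmallKθ : K₀ * (m * Kc kap) * (θ * (m * Kc kap'')) < 1)
    {c g : ℝ} (hc0 : 0 ≤ c) (hc : ∀ k, hC.1.eigenvalues k ≤ c)
    (hαc : (2 * (θ * (m * Kc kap'')) + (κ + a₀)) * c ≤ 1 / 2) (hg : 0 ≤ g)
    (hΓq : ∀ X : Λ ⊕ C₀ → ℝ, (Γ₀ *ᵥ X) ⬝ᵥ (C *ᵥ (Γ₀ *ᵥ X)) ≤ g * (X ⬝ᵥ X))
    (hsmall : (2 * (θ * (m * Kc kap'')) + (κ + a₀)) * (1 + 2 * c * g) ≤ 1 / 2) :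
    ‖cgaussMean (1 : Matrix (Λ ⊕ C₀) (Λ ⊕ C₀) ℂ) (fun X => integrand214 A Γ (F214 cardP χY₀ χcP Dfam V₀ τ) X)
        - cgaussMean (1 : Matrix (Λ ⊕ C₀) (Λ ⊕ C₀) ℂ)
            (fun X => integrand214 A Γ (F214 cardP (fun _ => 1) (fun _ => 1) Dfam V₀ τ) X)‖
      ≤ Real.exp (-(κ / 2 * R ^ 2)) * (Real.exp (2 * (K₀ * (m * Kc kap) * (θ * (m * Kc kap''))
              * (1 + (1 - K₀ * (m * Kc kap) * (θ * (m * Kc kap'')))⁻¹) / 2) * Fintype.card Λ) * Real.exp w₀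
          * (Real.exp ((2 * (θ * (m * Kc kap'')) + (κ + a₀)) * c * Fintype.card Λ)
            * Real.exp ((2 * (θ * (m * Kc kap'')) + (κ + a₀)) * (1 + 2 * c * g) * Fintype.card (Λ ⊕ C₀)))) := by
  -- shorthand for the located constants
  set θ' : ℝ := θ * (m * Kc kap'') with hθ'
  set η : ℝ := K₀ * (m * Kc kap) * (θ * (m * Kc kap'')) * (1 + (1 - K₀ * (m * Kc kap) * (θ * (m * Kc kap'')))⁻¹) / 2
    with hη
  have hθ : 0 ≤ θ := hθE.trans hθEle
  have hkap : 0 < kap := hkap''.trans (hk1.trans hk2)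
  have hkk : kap'' ≤ kap := (hk1.trans hk2).le
  have hθ'0 : 0 ≤ θ' := mul_nonneg hθ (mul_nonneg (Nat.cast_nonneg m) (hKc0 _ hkap''))
  have hexp : ∀ x : ℝ, 0 ≤ Real.exp x := fun x => (Real.exp_pos x).le
  -- entrywise (2.16) for R₁, E, R₃ at rate κ″ with the common majorant θ
  have h216R1 : ∀ b b', ‖(Γ₀ᵀ * C * Γ₀ - (Gᵀ * A⁻¹ * G).map Complex.re) b b'‖
      ≤ θ * Real.exp (-(kap'' * ρ (locN b) (locN b'))) := fun b b' =>
    (h216R1_of_factors hρ hρs hKc hKc0 hθΓ hθC hKG hKΓ hKCs hK₀ hkap''.le hk1 hk2 locΛ locN hfibΛ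
      hdΓ hdC hG hΓ₀ hCs hC216 b b').trans (mul_le_mul_of_nonneg_right hθR1le (hexp _))
  have h216E : ∀ b b', ‖(A - C⁻¹.map (algebraMap ℝ ℂ)) b b'‖ ≤ θ * Real.exp (-(kap'' * ρ (locΛ b) (locΛ b'))) :=
    fun b b' => (entry_bound_mono_rate hρ hθE hkk locΛ locΛ hdE b b').trans (mul_le_mul_of_nonneg_right hθEle (hexp _))
  have h216R3 : ∀ i j, ‖(G.map Complex.re - Γ₀) i j‖ ≤ θ * Real.exp (-(kap'' * ρ (locΛ i) (locN j))) := by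
    have hmono : ∀ i j, ‖(G - Γ₀.map (algebraMap ℝ ℂ)) i j‖ ≤ θ * Real.exp (-(kap'' * ρ (locΛ i) (locN j))) :=
      fun i j => (entry_bound_mono_rate hρ hθΓ hkk locΛ locN hdΓ i j).trans (mul_le_mul_of_nonneg_right hθΓle (hexp _))
    exact fun i j => h216R3_of_diff hmono i j
  -- the replacement letters in their printed (form) shapes
  have hR1 : ∀ X : Λ ⊕ C₀ → ℝ, -(1 / 2) * ((Γ X) ⬝ᵥ (A⁻¹ *ᵥ Γ X)).re
      ≤ -(1 / 2 * ((Γ₀ *ᵥ X) ⬝ᵥ (C *ᵥ (Γ₀ *ᵥ X)))) + θ' / 2 * (X ⬝ᵥ X) := fun X =>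
    hR1_of_entrywise hρ hρs hKc Γ Γ₀ _ hθ hkap'' locN hfibN (hdef1_of_linear A G Γ hlin C Γ₀) h216R1 X
  have h17a := h17a_of_entrywise hρ hρs hKc hC hA hθ hkap'' hK₀ hkap locΛ hfibΛ hC216 h216E hsmallKθ
  have h17b := h17b_of_entrywise hρ hρs hKc hC hA hθ hkap'' hK₀ hkap locΛ hfibΛ hC216 h216E hsmallKθ
  have hR2 : ∀ B : Λ → ℝ, B ⬝ᵥ ((C⁻¹ - A.map Complex.re) *ᵥ B) ≤ θ' * (B ⬝ᵥ B) := fun B =>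
    hR2_of_entrywise hρ hρs hKc hθ hkap'' locΛ hfibΛ h216E B
  have hR3 : ∀ (X : Λ ⊕ C₀ → ℝ) (B : Λ → ℝ), -(B ⬝ᵥ fun i => (Γ X i).re)
      ≤ -(B ⬝ᵥ (Γ₀ *ᵥ X)) + θ' / 2 * (X ⬝ᵥ X + B ⬝ᵥ B) := fun X B =>
    hR3_of_entrywise hρs hKc Γ Γ₀ _ hθ hkap'' locΛ locN hfibΛ hfibN (hdef3_of_linear G Γ hlin Γ₀) h216R3 X B
  have hΓc : Continuous Γ := continuous_of_linear G Γ hlin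
  have hΓodd : ∀ X, Γ (-X) = -Γ X := fun X => by
    have h1 : (fun j => (((-X) j : ℝ) : ℂ)) = -fun j => ((X j : ℝ) : ℂ) := by
      funext j; simp only [Pi.neg_apply, Complex.ofReal_neg]
    rw [hlin, hlin, h1, Matrix.mulVec_neg]
  -- numerics at the rate α = 2θ′ + κ + a₀
  have hα0 : 0 ≤ 2 * θ' + (κ + a₀) := by positivity
  have hαlt : (2 * θ' + (κ + a₀)) * (1 + 2 * c * g) < 1 := lt_of_le_of_lt hsmall (by norm_num)
  -- the F-generic centred (2.23) with ℓ := 0 at these letters, then the (2.24)–(2.26) volume bound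
  have h223 := norm_core214_boxTail_le_223_of_letters hAs hA hΓc hΓodd cardP hχm hχcm hχ0 hχc0 hχ1 hκ hbox Dfam hV₀m τ
    ha₀ h220 hC Γ₀ hθ'0 hR1 h17a h17b hR2 hR3 hc0 hc hαc hΓq hαlt
  have h226 := integral223_le hC Γ₀ hα0 hc0 hc hαc hg hΓq hsmall
  have hK0 : 0 ≤ Real.exp (2 * η * Fintype.card Λ) * (Real.exp (-(κ / 2 * R ^ 2)) * Real.exp w₀) := by positivity
  calc ‖cgaussMean (1 : Matrix (Λ ⊕ C₀) (Λ ⊕ C₀) ℂ) (fun X => integrand214 A Γ (F214 cardP χY₀ χcP Dfam V₀ τ) X)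
          - cgaussMean (1 : Matrix (Λ ⊕ C₀) (Λ ⊕ C₀) ℂ)
            (fun X => integrand214 A Γ (F214 cardP (fun _ => 1) (fun _ => 1) Dfam V₀ τ) X)‖
      ≤ Real.exp (2 * η * Fintype.card Λ) * (Real.exp (-(κ / 2 * R ^ 2)) * Real.exp w₀)
          * integral223 C Γ₀ (2 * θ' + (κ + a₀)) := h223
    _ ≤ Real.exp (2 * η * Fintype.card Λ) * (Real.exp (-(κ / 2 * R ^ 2)) * Real.exp w₀)
          * (Real.exp ((2 * θ' + (κ + a₀)) * c * Fintype.card Λ)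
            * Real.exp ((2 * θ' + (κ + a₀)) * (1 + 2 * c * g) * Fintype.card (Λ ⊕ C₀))) :=
        mul_le_mul_of_nonneg_left h226 hK0
    _ = Real.exp (-(κ / 2 * R ^ 2)) * (Real.exp (2 * η * Fintype.card Λ) * Real.exp w₀
          * (Real.exp ((2 * θ' + (κ + a₀)) * c * Fintype.card Λ)
            * Real.exp ((2 * θ' + (κ + a₀)) * (1 + 2 * c * g) * Fintype.card (Λ ⊕ C₀)))) := by ring

end Pointwise

/-! ## §2. On the two-scale torus, along the window-dilated family, `P = ∅`: the box tail from the primitive letters at `b = 1` -/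

section Torus

variable {d L N' : ℕ} [NeZero L] [NeZero N'] {M : ℕ}
variable {ν : ℕ} {Nf : Fin ν → ℕ} [∀ i, NeZero (Nf i)]
variable {Λ : Type} [Fintype Λ] [DecidableEq Λ] {C₀ : Type} [Fintype C₀] [DecidableEq C₀]

open Classical in
/-- **THE BOX TAIL ALONG THE WINDOW-DILATED FAMILY, for one term of the torus model WITHOUT large-field boxes, from the
PRIMITIVE letters at `b = 1`** (lens Card T24 at term level; node N22's (S-vertex-T′), second half of the two-step centre).
Data and letters AT THE REAL COUPLING as in `B13Term214WindowDilated.h226_torus_windowDilated_of_primitives` (kernels `A(σ)`,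
`Γ(σ)X = G(σ)·X`, the reference `C ≻ 0`, `Γ₀`, the (L17a)∕(L16a) letters on the open σ-polydisc, `K_E`, the radius `ρ_b < 1`
and the primed letters), and for the last line: characteristic functions `χ, χᶜ` measurable with `0 ≤ χ`, `0 ≤ χᶜ`, `χχᶜ ≤ 1`
and the BOX LAW `χχᶜ = 1` on `⟨B,B⟩ < R²`; the centre's potentials `𝐕₀(Y,·)` measurable with `Σ|τ||𝐕₀| ≤ ½a₀‖B‖² + w₀` on
the per-domain τ-region; NO large-field boxes (`|P| = 0`); a rate `κ ≥ 0`; the capstone's numeric conditions and `hvol` at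
`α = 2θ′ + κ + a₀` with `w₀`.  Conclusion: for every `b` of the ball, `‖term(b²A, bΓ, F214 χ χᶜ 𝐕₀) − term(b²A, bΓ, F214 1 1 𝐕₀)‖
≤ e^{−½κR²}·weight L M c Z a t·exp(a₅|Z|)` — §1 pointwise on the polydiscs at the transported letters (`Re(b²A(σ)) ≻ 0`
derived), both `X`-integrals separately holomorphic from the primitives, the Cauchy layer `norm_term214_le_215_polyτ` on their
difference, `term214_sub_of_sepHolOnPoly`, and the p. 17 constant matching.  With `R = p(s)∕s` the constant is `O(s²)`
(`B13Term214CentredPieces.boxTail_rate`).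
[cite: Balaban1988RG2Cluster, (2.14)–(2.15) p.15, (2.16)–(2.22) p.16, (2.23)–(2.26) p.17; Balaban1987RG1, (2.10)-(2.13) pp.266-268] -/
theorem h226_torus_windowDilated_boxTail_of_primitives (c : B13.Consts) (hκ₁ : 1 ≤ c.κ₁) (hα₆ : c.α₆ ≠ 0)
    (Z : TDom d N') (t : Finset (TDom d (L * N')) × Finset (TBond d M (L * N')))
    (hpos : ∀ Y : TDom d (L * N'), 0 < invTau c ((tsys d (L * N')).dj Y))
    (hhalf : ∀ Y : TDom d (L * N'), invTau c ((tsys d (L * N')).dj Y) ≤ 1 / 2)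
    {Uσ : Set ℂ} {Uτ : TDom d (L * N') → Set ℂ} (hUσ : IsOpen Uσ) (hUτ : ∀ Y, IsOpen (Uτ Y))
    (hUexp : closedBall (0 : ℂ) (Real.exp c.κ₁) ⊆ Uσ)
    (hUtau : ∀ Y : TDom d (L * N'), closedBall (0 : ℂ) ((invTau c ((tsys d (L * N')).dj Y))⁻¹) ⊆ Uτ Y)
    {r : ℝ} (hr : 0 < r) (hr' : r ≤ Real.exp c.κ₁ - 1)
    (hsubτ : ∀ Y, ∀ s ∈ Set.uIcc (0 : ℝ) 1, closedBall (s : ℂ) r ⊆ Uτ Y)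
    (lZ : List (TPt d N')) (hlZ : lZ.Nodup ∧ lZ.toFinset = Z.1 \ tclosure L N' (Z0 M t))
    (lD : List (TDom d (L * N'))) (hlD : lD.Nodup ∧ lD.toFinset = t.1)
    -- the (2.14)-data AT THE REAL COUPLING (b = 1)
    (A : (TPt d N' → ℂ) → Matrix Λ Λ ℂ) (Γ : (TPt d N' → ℂ) → (Λ ⊕ C₀ → ℝ) → (Λ → ℂ))
    {χY₀ χcP : (Λ → ℝ) → ℝ} (hχ0 : ∀ B, 0 ≤ χY₀ B) (hχc0 : ∀ B, 0 ≤ χcP B) (hχ1 : ∀ B, χY₀ B * χcP B ≤ 1)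
    {R κ : ℝ} (hκ : 0 ≤ κ) (hbox : ∀ B, B ⬝ᵥ B < R ^ 2 → χY₀ B * χcP B = 1)
    (Dfam : Finset (TDom d (L * N'))) {V₀ : TDom d (L * N') → (Λ → ℝ) → ℂ}
    {C : Matrix Λ Λ ℝ} (hC : C.PosDef) (Γ₀ : Matrix Λ (Λ ⊕ C₀) ℝ)
    (hAhol : ∀ i j, DifferentiableOn ℂ (fun σ => A σ i j) {σ | ∀ j, σ j ∈ Uσ})
    (hχm : Measurable χY₀) (hχcm : Measurable χcP) (hV₀m : ∀ Y, Measurable (V₀ Y))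
    (hAs : ∀ σ : TPt d N' → ℂ, (∀ j, σ j ∈ Uσ) → (A σ).IsSymm)
    (G : (TPt d N' → ℂ) → Matrix Λ (Λ ⊕ C₀) ℂ)
    (hGhol : ∀ i j, DifferentiableOn ℂ (fun σ => G σ i j) {σ | ∀ j, σ j ∈ Uσ})
    (hlin : ∀ σ : TPt d N' → ℂ, (∀ j, σ j ∈ Uσ) → ∀ X : Λ ⊕ C₀ → ℝ, Γ σ X = G σ *ᵥ fun j => (X j : ℂ))
    -- no large-field boxes; the centre's potentials on the open per-domain τ-region
    (hP0 : t.2.card = 0) {a₀ w₀ : ℝ} (ha₀ : 0 ≤ a₀)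
    (h220U : ∀ τ : TDom d (L * N') → ℂ, (∀ Y, τ Y ∈ Uτ Y) →
      ∀ B, ∑ Y ∈ Dfam, ‖τ Y‖ * ‖V₀ Y B‖ ≤ a₀ / 2 * (B ⬝ᵥ B) + w₀)
    -- bonds located on the torus `UT Nf`
    (locΛ : Λ → UT Nf) (locN : Λ ⊕ C₀ → UT Nf) {m : ℕ}
    (hfibΛ : ∀ x : UT Nf, (Finset.univ.filter fun i => locΛ i = x).card ≤ m)
    (hfibN : ∀ x : UT Nf, (Finset.univ.filter fun j => locN j = x).card ≤ m)
    -- rates and the letters AT b = 1 (+ K_E)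
    {kap kap' kap'' θ θE θΓ θC KG KΓ KCs K₀ KE : ℝ} (hkap'' : 0 < kap'') (hk1 : kap'' < kap') (hk2 : kap' < kap)
    (hθE : 0 ≤ θE) (hθΓ : 0 ≤ θΓ) (hθC : 0 ≤ θC) (hKG : 0 ≤ KG) (hKΓ : 0 ≤ KΓ) (hKCs : 0 ≤ KCs) (hK₀ : 0 ≤ K₀)
    (hKE : 0 ≤ KE)
    (hG : ∀ σ : TPt d N' → ℂ, (∀ j, σ j ∈ Uσ) →
      ∀ b j, ‖G σ b j‖ ≤ KG * Real.exp (-(kap * tdist1 Nf (locΛ b) (locN j))))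
    (hΓ₀ : ∀ b j, ‖Γ₀ b j‖ ≤ KΓ * Real.exp (-(kap * tdist1 Nf (locΛ b) (locN j))))
    (hCs : ∀ σ : TPt d N' → ℂ, (∀ j, σ j ∈ Uσ) →
      ∀ b b', ‖(A σ)⁻¹ b b'‖ ≤ KCs * Real.exp (-(kap * tdist1 Nf (locΛ b) (locΛ b'))))
    (hC216 : ∀ b b', ‖C b b'‖ ≤ K₀ * Real.exp (-(kap * tdist1 Nf (locΛ b) (locΛ b'))))
    (hCE : ∀ b b', ‖(C⁻¹.map (algebraMap ℝ ℂ)) b b'‖ ≤ KE * Real.exp (-(kap * tdist1 Nf (locΛ b) (locΛ b'))))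
    (hdΓ : ∀ σ : TPt d N' → ℂ, (∀ j, σ j ∈ Uσ) →
      ∀ b j, ‖(G σ - Γ₀.map (algebraMap ℝ ℂ)) b j‖ ≤ θΓ * Real.exp (-(kap * tdist1 Nf (locΛ b) (locN j))))
    (hdC : ∀ σ : TPt d N' → ℂ, (∀ j, σ j ∈ Uσ) →
      ∀ b b', ‖((A σ)⁻¹ - C.map (algebraMap ℝ ℂ)) b b'‖
        ≤ θC * Real.exp (-(kap * tdist1 Nf (locΛ b) (locΛ b'))))
    (hdE : ∀ σ : TPt d N' → ℂ, (∀ j, σ j ∈ Uσ) →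
      ∀ b b', ‖(A σ - C⁻¹.map (algebraMap ℝ ℂ)) b b'‖ ≤ θE * Real.exp (-(kap * tdist1 Nf (locΛ b) (locΛ b'))))
    {ρb KG' KCs' θΓ' θC' θE' : ℝ} (hρb1 : ρb < 1)
    (hKG' : (1 + ρb) * KG ≤ KG') (hKCs' : ((1 - ρb) ^ 2)⁻¹ * KCs ≤ KCs')
    (hθΓ' : θΓ + ρb * KG ≤ θΓ') (hθC' : θC + ρb * (2 + ρb) * ((1 - ρb) ^ 2)⁻¹ * KCs ≤ θC')
    (hθE' : θE + ρb * (2 + ρb) * (θE + KE) ≤ θE')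
    -- the capstone's numeric conditions in the primed letters, at the rate κ + a₀, with w₀
    (hθEle : θE' ≤ θ) (hθΓle : θΓ' ≤ θ)
    (hθR1le : (m * (1 + 2 / (kap - kap')) ^ ν) * (m * (1 + 2 / (kap' - kap'')) ^ ν)
      * (θΓ' * KCs' * KG' + KΓ * θC' * KG' + KΓ * K₀ * θΓ') ≤ θ)
    (hsmallKθ : K₀ * (m * (1 + 2 / kap) ^ ν) * (θ * (m * (1 + 2 / kap'') ^ ν)) < 1)
    {cE g : ℝ} (hc0 : 0 ≤ cE) (hc : ∀ k, hC.1.eigenvalues k ≤ cE)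
    (hαc : (2 * (θ * (m * (1 + 2 / kap'') ^ ν)) + (κ + a₀)) * cE ≤ 1 / 2) (hg : 0 ≤ g)
    (hΓq : ∀ X : Λ ⊕ C₀ → ℝ, (Γ₀ *ᵥ X) ⬝ᵥ (C *ᵥ (Γ₀ *ᵥ X)) ≤ g * (X ⬝ᵥ X))
    (hsmall : (2 * (θ * (m * (1 + 2 / kap'') ^ ν)) + (κ + a₀)) * (1 + 2 * cE * g) ≤ 1 / 2)
    {a a₅ : ℝ}
    (hvol : 2 * (K₀ * (m * (1 + 2 / kap) ^ ν) * (θ * (m * (1 + 2 / kap'') ^ ν))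
              * (1 + (1 - K₀ * (m * (1 + 2 / kap) ^ ν) * (θ * (m * (1 + 2 / kap'') ^ ν)))⁻¹) / 2)
          * (Fintype.card Λ : ℝ)
        + w₀ + (2 * (θ * (m * (1 + 2 / kap'') ^ ν)) + (κ + a₀)) * cE * (Fintype.card Λ : ℝ)
        + (2 * (θ * (m * (1 + 2 / kap'') ^ ν)) + (κ + a₀)) * (1 + 2 * cE * g) * (Fintype.card (Λ ⊕ C₀) : ℝ)
        ≤ a₅ * ((Z.1).card : ℝ))
    {b : ℂ} (hb : b ∈ ball (1 : ℂ) ρb) :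
    ‖term214 r lZ lD (core214 (fun σ => b ^ 2 • A σ) (fun σ X => b • Γ σ X)
          (F214 t.2.card χY₀ χcP Dfam V₀)) 0 0
        - term214 r lZ lD (core214 (fun σ => b ^ 2 • A σ) (fun σ X => b • Γ σ X)
          (F214 t.2.card (fun _ => 1) (fun _ => 1) Dfam V₀)) 0 0‖ ≤
      Real.exp (-(κ / 2 * R ^ 2)) * (weight L M c Z a t * Real.exp (a₅ * ((Z.1).card : ℝ))) := by
  obtain ⟨hlZ1, hlZ2⟩ := hlZ
  obtain ⟨hlD1, hlD2⟩ := hlD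
  have hρb0 : 0 ≤ ρb := rad_nonneg_of_mem_ball hb
  have hexp : ∀ x : ℝ, 0 ≤ Real.exp x := fun x => (Real.exp_pos x).le
  have hθ : 0 ≤ θ := le_trans (le_trans (by positivity) hθE') hθEle
  have hkk : kap'' ≤ kap := (hk1.trans hk2).le
  have hκa0 : 0 ≤ κ + a₀ := add_nonneg hκ ha₀
  have hBB : ∀ B : Λ → ℝ, 0 ≤ B ⬝ᵥ B := fun B => Finset.sum_nonneg fun i _ => mul_self_nonneg (B i)
  -- the τ-radii `|τ(Y)| = (invTau …)⁻¹ ≥ 2`, the σ-discs, membership of the polydiscs in the regions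
  set Rτ : TDom d (L * N') → ℝ := fun Y => (invTau c ((tsys d (L * N')).dj Y))⁻¹ with hRτ
  have hR2 : ∀ Y, (2 : ℝ) ≤ Rτ Y := fun Y => by
    rw [hRτ]; dsimp only; rw [le_inv_comm₀ (by norm_num) (hpos Y)]; simpa [one_div] using hhalf Y
  have hsubσ : ∀ x ∈ Set.uIcc (0 : ℝ) 1, closedBall (x : ℂ) r ⊆ Uσ :=
    fun x hx => (closedBall_subset_closedBall_of_mem_uIcc hr' hx).trans hUexp
  have h0σ : (0 : ℂ) ∈ Uσ := by simpa using hsubσ 0 (by simp) (mem_closedBall_self hr.le)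
  have h0τ : ∀ Y, (0 : ℂ) ∈ Uτ Y := fun Y => by simpa using hsubτ Y 0 (by simp) (mem_closedBall_self hr.le)
  have hσU : ∀ σ : TPt d N' → ℂ, (∀ j, ‖σ j‖ ≤ Real.exp c.κ₁) → ∀ j, σ j ∈ Uσ :=
    fun σ hσ j => hUexp (mem_closedBall_zero_iff.2 (hσ j))
  have hτU : ∀ τ : TDom d (L * N') → ℂ, (∀ Y, ‖τ Y‖ ≤ Rτ Y) → ∀ Y, τ Y ∈ Uτ Y :=
    fun τ hτ Y => hUtau Y (mem_closedBall_zero_iff.2 (hτ Y))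
  -- the dilated kernels and their transported letters at this `b`
  set A' : (TPt d N' → ℂ) → Matrix Λ Λ ℂ := fun σ => b ^ 2 • A σ with hA'
  set G' : (TPt d N' → ℂ) → Matrix Λ (Λ ⊕ C₀) ℂ := fun σ => b • G σ with hG'def
  set Γ' : (TPt d N' → ℂ) → (Λ ⊕ C₀ → ℝ) → (Λ → ℂ) := fun σ X => b • Γ σ X with hΓ'
  have hlin' : ∀ σ : TPt d N' → ℂ, (∀ j, σ j ∈ Uσ) → ∀ X : Λ ⊕ C₀ → ℝ,
      Γ' σ X = G' σ *ᵥ fun j => (X j : ℂ) := fun σ hσ X => by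
    simp only [hΓ', hG'def]; rw [hlin σ hσ X, Matrix.smul_mulVec]
  have hAs' : ∀ σ : TPt d N' → ℂ, (∀ j, σ j ∈ Uσ) → (A' σ).IsSymm := fun σ hσ => (hAs σ hσ).smul _
  have hAhol' : ∀ i j, DifferentiableOn ℂ (fun σ => A' σ i j) {σ | ∀ j, σ j ∈ Uσ} := fun i j => by
    simpa only [hA', Matrix.smul_apply, smul_eq_mul] using (hAhol i j).const_mul (b ^ 2)
  have hGhol' : ∀ i j, DifferentiableOn ℂ (fun σ => G' σ i j) {σ | ∀ j, σ j ∈ Uσ} := fun i j => by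
    simpa only [hG'def, Matrix.smul_apply, smul_eq_mul] using (hGhol i j).const_mul b
  have hGl : ∀ σ : TPt d N' → ℂ, (∀ j, σ j ∈ Uσ) →
      ∀ i j, ‖G' σ i j‖ ≤ KG' * Real.exp (-(kap * tdist1 Nf (locΛ i) (locN j))) := fun σ hσ i j =>
    (smul_entry_le (hG σ hσ) hb i j).trans (mul_le_mul_of_nonneg_right hKG' (hexp _))
  have hCsl : ∀ σ : TPt d N' → ℂ, (∀ j, σ j ∈ Uσ) →
      ∀ i j, ‖(A' σ)⁻¹ i j‖ ≤ KCs' * Real.exp (-(kap * tdist1 Nf (locΛ i) (locΛ j))) := fun σ hσ i j =>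
    (inv_sq_smul_entry_le (hCs σ hσ) hρb1 hb i j).trans (mul_le_mul_of_nonneg_right hKCs' (hexp _))
  have hdΓl : ∀ σ : TPt d N' → ℂ, (∀ j, σ j ∈ Uσ) →
      ∀ i j, ‖(G' σ - Γ₀.map (algebraMap ℝ ℂ)) i j‖ ≤ θΓ' * Real.exp (-(kap * tdist1 Nf (locΛ i) (locN j))) :=
    fun σ hσ i j => (smul_sub_entry_le (hG σ hσ) (hdΓ σ hσ) hb i j).trans (mul_le_mul_of_nonneg_right hθΓ' (hexp _))
  have hdCl : ∀ σ : TPt d N' → ℂ, (∀ j, σ j ∈ Uσ) →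
      ∀ i j, ‖((A' σ)⁻¹ - C.map (algebraMap ℝ ℂ)) i j‖
        ≤ θC' * Real.exp (-(kap * tdist1 Nf (locΛ i) (locΛ j))) := fun σ hσ i j =>
    (inv_sq_smul_sub_entry_le (hCs σ hσ) (hdC σ hσ) hρb1 hb i j).trans (mul_le_mul_of_nonneg_right hθC' (hexp _))
  have hdEl : ∀ σ : TPt d N' → ℂ, (∀ j, σ j ∈ Uσ) →
      ∀ i j, ‖(A' σ - C⁻¹.map (algebraMap ℝ ℂ)) i j‖
        ≤ θE' * Real.exp (-(kap * tdist1 Nf (locΛ i) (locΛ j))) := fun σ hσ i j =>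
    (sq_smul_sub_entry_le hCE (hdE σ hσ) hb i j).trans (mul_le_mul_of_nonneg_right hθE' (hexp _))
  have hA' : ∀ σ : TPt d N' → ℂ, (∀ j, σ j ∈ Uσ) → ((A' σ).map Complex.re).PosDef := by
    intro σ hσ
    have h216E : ∀ i j, ‖(A' σ - C⁻¹.map (algebraMap ℝ ℂ)) i j‖
        ≤ θ * Real.exp (-(kap'' * tdist1 Nf (locΛ i) (locΛ j))) := fun i j =>
      (entry_bound_mono_rate (weightHyp_tdist1 (N := Nf)) (le_trans (by positivity) hθE') hkk locΛ locΛ (hdEl σ hσ)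
        i j).trans (mul_le_mul_of_nonneg_right hθEle (hexp _))
    refine posDef_re_of_form (hAs' σ hσ) hC hc
      (hR2_of_entrywise (weightHyp_tdist1 (N := Nf)) tdist1_symm kc_tdist1 hθ hkap'' locΛ hfibΛ h216E) ?_
    exact theta_mul_lt_one hκ ha₀ hc0 hαc
  -- non-negativity of the primed letters
  have hθE'0 : 0 ≤ θE' := le_trans (by positivity) hθE'
  have hθΓ'0 : 0 ≤ θΓ' := le_trans (by positivity) hθΓ'
  have hθC'0 : 0 ≤ θC' := le_trans (by positivity) hθC'
  have hKG'0 : 0 ≤ KG' := le_trans (by positivity) hKG'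
  have hKCs'0 : 0 ≤ KCs' := le_trans (by positivity) hKCs'
  -- the two last lines: χ-data (χ, χᶜ) and (1, 1), both with `χχᶜ ≤ 1`; (2.22) at radius 0, growth at rate κ + a₀
  have h11 : ∀ B : Λ → ℝ, (fun _ : Λ → ℝ => (1 : ℝ)) B * (fun _ : Λ → ℝ => (1 : ℝ)) B ≤ 1 := fun B => by norm_num
  have h222W : ∀ {χ χc : (Λ → ℝ) → ℝ}, (∀ B, χ B * χc B ≤ 1) → ∀ B,
      χ B * χc B ≤ Real.exp (-(κ / 2 * (0 : ℝ) ^ 2 * (t.2.card : ℕ)) + κ / 2 * (B ⬝ᵥ B)) :=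
    fun {χ χc} h1 B => chi_le_h222_zero_radius h1 hκ _ B
  have hFbW : ∀ {χ χc : (Λ → ℝ) → ℝ}, (∀ B, 0 ≤ χ B) → (∀ B, 0 ≤ χc B) → (∀ B, χ B * χc B ≤ 1) →
      ∀ τ : TDom d (L * N') → ℂ, (∀ Y, τ Y ∈ Uτ Y) → ∀ B,
        ‖F214 t.2.card χ χc Dfam V₀ τ B‖ ≤ Real.exp w₀ * Real.exp ((κ + a₀) / 2 * (B ⬝ᵥ B)) :=
    fun {χ χc} h0 hc0' h1 τ hτ B =>
      norm_F214_le_of_chi_le_one t.2.card Dfam V₀ τ B (h0 B) (hc0' B) (h1 B) hκ (h220U τ hτ B)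
  -- the σ-slot and the τ-slot of the X-integrals, generic in the χ-data
  have hΨσW : ∀ (χ χc : (Λ → ℝ) → ℝ) (_ : Measurable χ) (_ : Measurable χc) (_ : ∀ B, 0 ≤ χ B) (_ : ∀ B, 0 ≤ χc B)
      (_ : ∀ B, χ B * χc B ≤ 1) (τ : TDom d (L * N') → ℂ), (∀ Y, τ Y ∈ Uτ Y) →
      SepHolOn Uσ (fun σ => core214 A' Γ' (F214 t.2.card χ χc Dfam V₀) σ τ) :=
      fun χ χc hm hcm h0 hc0' h1 τ hτ =>
    sepHolOn_core214_sigma_of_primitives (weightHyp_tdist1 (N := Nf)) tdist1_symm kc_tdist1 kc_l1_nonneg hUσ A' Γ' G'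
      hAhol' hGhol' hAs' hA' hlin' (F214 t.2.card χ χc Dfam V₀) τ
      (measurable_F214 t.2.card hm hcm Dfam hV₀m τ).stronglyMeasurable (hexp w₀) hκa0 (hFbW h0 hc0' h1 τ hτ)
      hC Γ₀ locΛ locN hfibΛ hfibN hkap'' hk1 hk2 hθE'0 hθΓ'0 hθC'0 hKG'0 hKΓ hKCs'0 hK₀ hθEle hθΓle hθR1le hGl hΓ₀ hCsl
      hC216 hdΓl hdCl hdEl hsmallKθ hc0 hc hαc hΓq hsmall
  have hΨτW : ∀ (χ χc : (Λ → ℝ) → ℝ) (_ : Measurable χ) (_ : Measurable χc) (_ : ∀ B, 0 ≤ χ B) (_ : ∀ B, 0 ≤ χc B)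
      (_ : ∀ B, χ B * χc B ≤ 1) (σ : TPt d N' → ℂ), (∀ j, σ j ∈ Uσ) →
      SepHolOnPoly Uτ (fun τ => core214 A' Γ' (F214 t.2.card χ χc Dfam V₀) σ τ) :=
      fun χ χc hm hcm h0 hc0' h1 σ hσ =>
    sepHolOnPoly_core214_tau_of_primitives (weightHyp_tdist1 (N := Nf)) tdist1_symm kc_tdist1 kc_l1_nonneg hUτ A' Γ' G' σ
      (hAs' σ hσ) (hA' σ hσ) (hlin' σ hσ) t.2.card hm hcm h0 hc0' Dfam hV₀m (fun B => B ⬝ᵥ B) (h222W h1) hκ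
      (fun _ => le_rfl) ha₀ h220U hC Γ₀ locΛ locN hfibΛ hfibN hkap'' hk1 hk2 hθE'0 hθΓ'0 hθC'0 hKG'0 hKΓ hKCs'0 hK₀
      hθEle hθΓle hθR1le (hGl σ hσ) hΓ₀ (hCsl σ hσ) hC216 (hdΓl σ hσ) (hdCl σ hσ) (hdEl σ hσ) hsmallKθ hc0 hc hαc hΓq
      hsmall
  have hm1 : Measurable (fun _ : Λ → ℝ => (1 : ℝ)) := measurable_const
  have hΨσ := hΨσW χY₀ χcP hχm hχcm hχ0 hχc0 hχ1
  have hΨ₀σ := hΨσW (fun _ => 1) (fun _ => 1) hm1 hm1 (fun _ => zero_le_one) (fun _ => zero_le_one) h11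
  have hΨτ := hΨτW χY₀ χcP hχm hχcm hχ0 hχc0 hχ1
  have hΨ₀τ := hΨτW (fun _ => 1) (fun _ => 1) hm1 hm1 (fun _ => zero_le_one) (fun _ => zero_le_one) h11
  -- the uniform box-tail bound on the closed polydiscs (§1 at the transported letters)
  set Kcen : ℝ := Real.exp (2 * (K₀ * (m * (1 + 2 / kap) ^ ν) * (θ * (m * (1 + 2 / kap'') ^ ν))
              * (1 + (1 - K₀ * (m * (1 + 2 / kap) ^ ν) * (θ * (m * (1 + 2 / kap'') ^ ν)))⁻¹) / 2) * Fintype.card Λ)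
          * Real.exp w₀
          * (Real.exp ((2 * (θ * (m * (1 + 2 / kap'') ^ ν)) + (κ + a₀)) * cE * Fintype.card Λ)
            * Real.exp ((2 * (θ * (m * (1 + 2 / kap'') ^ ν)) + (κ + a₀)) * (1 + 2 * cE * g) * Fintype.card (Λ ⊕ C₀)))
    with hKcen
  have hK : ∀ (σ : TPt d N' → ℂ) (τ : TDom d (L * N') → ℂ), (∀ j, ‖σ j‖ ≤ Real.exp c.κ₁) → (∀ Y, ‖τ Y‖ ≤ Rτ Y) →
      ‖core214 A' Γ' (F214 t.2.card χY₀ χcP Dfam V₀) σ τ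
          - core214 A' Γ' (F214 t.2.card (fun _ => 1) (fun _ => 1) Dfam V₀) σ τ‖
        ≤ Real.exp (-(κ / 2 * R ^ 2)) * Kcen := by
    intro σ τ hσ hτ
    have hσ' := hσU σ hσ
    have hτ' := hτU τ hτ
    exact norm_core214_boxTail_le_K_of_primitives (weightHyp_tdist1 (N := Nf)) tdist1_symm kc_tdist1 kc_l1_nonneg
      (hAs' σ hσ') (hA' σ hσ') (hlin' σ hσ') hC Γ₀ t.2.card hχm hχcm hχ0 hχc0 hχ1 hκ hbox Dfam hV₀m τ ha₀ (h220U τ hτ')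
      locΛ locN hfibΛ hfibN hkap'' hk1 hk2 hθE'0 hθΓ'0 hθC'0 hKG'0 hKΓ hKCs'0 hK₀ hθEle hθΓle hθR1le (hGl σ hσ') hΓ₀
      (hCsl σ hσ') hC216 (hdΓl σ hσ') (hdCl σ hσ') (hdEl σ hσ') hsmallKθ hc0 hc hαc hg hΓq hsmall
  -- the Cauchy layer on the DIFFERENCE of the two X-integrals
  have hDσ : ∀ τ : TDom d (L * N') → ℂ, (∀ Y, τ Y ∈ Uτ Y) → SepHolOn Uσ (fun σ =>
      core214 A' Γ' (F214 t.2.card χY₀ χcP Dfam V₀) σ τ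
        - core214 A' Γ' (F214 t.2.card (fun _ => 1) (fun _ => 1) Dfam V₀) σ τ) :=
    fun τ hτ i p hp => (hΨσ τ hτ i p hp).sub (hΨ₀σ τ hτ i p hp)
  have hDτ : ∀ σ : TPt d N' → ℂ, (∀ j, σ j ∈ Uσ) → SepHolOnPoly Uτ (fun τ =>
      core214 A' Γ' (F214 t.2.card χY₀ χcP Dfam V₀) σ τ
        - core214 A' Γ' (F214 t.2.card (fun _ => 1) (fun _ => 1) Dfam V₀) σ τ) :=
    fun σ hσ i p hp => (hΨτ σ hσ i p hp).sub (hΨ₀τ σ hσ i p hp)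
  have hmain := norm_term214_le_215_polyτ hκ₁ Rτ hR2 hUσ hUτ hUexp (fun Y => hUtau Y) hr hr' hsubτ hDσ hDτ hK hlZ1 hlD1
    (σ₀ := 0) (fun _ => by simp) (τ₀ := 0) (fun _ => by simp)
  -- identification: the term of the difference is the difference of the terms
  have hsub := term214_sub_of_sepHolOnPoly hUσ hUτ hr hsubσ hsubτ hΨσ hΨτ hΨ₀σ hΨ₀τ hlZ1 hlD1
    (σ₀ := 0) (fun _ => h0σ) (τ₀ := 0) (fun Y => h0τ Y)
  rw [← hsub]
  refine hmain.trans ?_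
  -- `|lZ| = #blocks(Z∖Z′₀)` and `2/|τ(Y)| = α₆ε₂e^{−(1−3δ)κd_k(Y)}`
  have hlen : ((lZ.length : ℕ) : ℝ) = ((Z.1 \ tclosure L N' (Z0 M t)).card : ℝ) := by
    rw [← List.toFinset_card_of_nodup hlZ1, hlZ2]
  have hprod : (∏ Y ∈ lD.toFinset, 2 * (Rτ Y)⁻¹) =
      ∏ Y ∈ t.1, c.α₆ * c.eps2 * Real.exp (-((1 - 3 * c.δ) * c.κ * (tsys d (L * N')).dj Y)) := by
    rw [hlD2]
    refine Finset.prod_congr rfl fun Y _ => ?_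
    rw [hRτ]; dsimp only
    rw [inv_inv, two_mul_invTau_eq c hα₆]
    ring_nf
  -- the volume factors (p. 17); no |P|-rate is spent (`|P| = 0`)
  have hPfac : Real.exp (-(a / 2 * (t.2.card : ℝ))) = 1 := by
    rw [hP0, Nat.cast_zero, mul_zero, neg_zero, Real.exp_zero]
  have hGauss : Kcen ≤ Real.exp (-(a / 2 * (t.2.card : ℝ))) * Real.exp (a₅ * ((Z.1).card : ℝ)) := by
    rw [hPfac, one_mul, hKcen, ← Real.exp_add, ← Real.exp_add, ← Real.exp_add, Real.exp_le_exp]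
    linarith only [hvol]
  have hF12 : 0 ≤ Real.exp (-(c.κ₁ - 1) * lZ.length) * ∏ Y ∈ lD.toFinset, 2 * (Rτ Y)⁻¹ :=
    mul_nonneg (Real.exp_nonneg _)
      (Finset.prod_nonneg fun Y _ => mul_nonneg zero_le_two (inv_nonneg.2 (by linarith only [hR2 Y])))
  calc Real.exp (-(c.κ₁ - 1) * lZ.length) * (∏ Y ∈ lD.toFinset, 2 * (Rτ Y)⁻¹) * (Real.exp (-(κ / 2 * R ^ 2)) * Kcen)
      ≤ Real.exp (-(c.κ₁ - 1) * lZ.length) * (∏ Y ∈ lD.toFinset, 2 * (Rτ Y)⁻¹)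
          * (Real.exp (-(κ / 2 * R ^ 2))
            * (Real.exp (-(a / 2 * (t.2.card : ℝ))) * Real.exp (a₅ * ((Z.1).card : ℝ)))) :=
        mul_le_mul_of_nonneg_left (mul_le_mul_of_nonneg_left hGauss (hexp _)) hF12
    _ = Real.exp (-(κ / 2 * R ^ 2)) * (weight L M c Z a t * Real.exp (a₅ * ((Z.1).card : ℝ))) := by
        rw [hprod, weight, ← hlen]
        ring_nf

/-! ## §3. The box-free centre with field-constant potentials is `b`-free on the torus -/

open Classical in
/-- **THE BOX-FREE CENTRE IS b-FREE, for one term of the torus model, from the PRIMITIVE letters at `b = 1`** (lens Card T25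
at term level; node N22's COUPLING-BLIND centre `V` per term).  With the boxes removed (`χ = χᶜ = 1`) and FIELD-CONSTANT
potentials `𝐕₀(Y, B) = O₀(Y)` (the older terms at the background) bounded by `Σ|τ||O₀| ≤ w₀` on the per-domain τ-region, the
window-dilated member `term(b²A, bΓ, F214 1 1 O₀)` does not depend on `b` on the ball `|b − 1| < ρ_b` (`ρ_b < 1`): it is
invariant under REAL dilations of `b` (`B13Term214WindowDilated.term214_dilate_family` — the substitution `B ↦ r⁻¹B` does
nothing to a field-constant last line) and holomorphic in `b` (`differentiableOn_term214_torus_windowDilated_of_primitives` at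
`χ := 1`, `W := 0`, `O := O₀`, whose (2.22) hypothesis reads `1 ≤ e^{½α₀⟨B,B⟩}`), hence constant
(`B13Term214CentredPieces.eq_of_radial_invariant`).  The numeric conditions are asked at any rate `α₀ ≥ 0` (those of
`h226_torus_windowDilated_boxTail_of_primitives` at `α₀ := κ + a₀` will do).  No Gaussian generating function.
[cite: Balaban1987RG1, (2.10)-(2.13) pp.266-268; Balaban1988RG2Cluster, (2.14)–(2.15) p.15, (2.16)–(2.22) p.16, (2.23)–(2.25) p.17] -/
theorem term214_torus_windowDilated_boxFree_eq_of_primitives (c : B13.Consts)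
    {Uσ : Set ℂ} {Uτ : TDom d (L * N') → Set ℂ} (hUσ : IsOpen Uσ) (hUτ : ∀ Y, IsOpen (Uτ Y))
    (hUexp : closedBall (0 : ℂ) (Real.exp c.κ₁) ⊆ Uσ)
    {r : ℝ} (hr : 0 < r) (hr' : r ≤ Real.exp c.κ₁ - 1)
    (hsubτ : ∀ Y, ∀ s ∈ Set.uIcc (0 : ℝ) 1, closedBall (s : ℂ) r ⊆ Uτ Y)
    {lZ : List (TPt d N')} (hlZ : lZ.Nodup) {lD : List (TDom d (L * N'))} (hlD : lD.Nodup)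
    (A : (TPt d N' → ℂ) → Matrix Λ Λ ℂ) (Γ : (TPt d N' → ℂ) → (Λ ⊕ C₀ → ℝ) → (Λ → ℂ))
    (cardP : ℕ) (Dfam : Finset (TDom d (L * N'))) (O₀ : TDom d (L * N') → ℂ)
    {C : Matrix Λ Λ ℝ} (hC : C.PosDef) (Γ₀ : Matrix Λ (Λ ⊕ C₀) ℝ)
    (hAhol : ∀ i j, DifferentiableOn ℂ (fun σ => A σ i j) {σ | ∀ j, σ j ∈ Uσ})
    (hAs : ∀ σ : TPt d N' → ℂ, (∀ j, σ j ∈ Uσ) → (A σ).IsSymm)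
    (G : (TPt d N' → ℂ) → Matrix Λ (Λ ⊕ C₀) ℂ)
    (hGhol : ∀ i j, DifferentiableOn ℂ (fun σ => G σ i j) {σ | ∀ j, σ j ∈ Uσ})
    (hlin : ∀ σ : TPt d N' → ℂ, (∀ j, σ j ∈ Uσ) → ∀ X : Λ ⊕ C₀ → ℝ, Γ σ X = G σ *ᵥ fun j => (X j : ℂ))
    {w₀ : ℝ} (hw₀U : ∀ τ : TDom d (L * N') → ℂ, (∀ Y, τ Y ∈ Uτ Y) → ∑ Y ∈ Dfam, ‖τ Y‖ * ‖O₀ Y‖ ≤ w₀)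
    (locΛ : Λ → UT Nf) (locN : Λ ⊕ C₀ → UT Nf) {m : ℕ}
    (hfibΛ : ∀ x : UT Nf, (Finset.univ.filter fun i => locΛ i = x).card ≤ m)
    (hfibN : ∀ x : UT Nf, (Finset.univ.filter fun j => locN j = x).card ≤ m)
    {kap kap' kap'' θ θE θΓ θC KG KΓ KCs K₀ KE : ℝ} (hkap'' : 0 < kap'') (hk1 : kap'' < kap') (hk2 : kap' < kap)
    (hθE : 0 ≤ θE) (hθΓ : 0 ≤ θΓ) (hθC : 0 ≤ θC) (hKG : 0 ≤ KG) (hKΓ : 0 ≤ KΓ) (hKCs : 0 ≤ KCs) (hK₀ : 0 ≤ K₀)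
    (hKE : 0 ≤ KE)
    (hG : ∀ σ : TPt d N' → ℂ, (∀ j, σ j ∈ Uσ) →
      ∀ b j, ‖G σ b j‖ ≤ KG * Real.exp (-(kap * tdist1 Nf (locΛ b) (locN j))))
    (hΓ₀ : ∀ b j, ‖Γ₀ b j‖ ≤ KΓ * Real.exp (-(kap * tdist1 Nf (locΛ b) (locN j))))
    (hCs : ∀ σ : TPt d N' → ℂ, (∀ j, σ j ∈ Uσ) →
      ∀ b b', ‖(A σ)⁻¹ b b'‖ ≤ KCs * Real.exp (-(kap * tdist1 Nf (locΛ b) (locΛ b'))))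
    (hC216 : ∀ b b', ‖C b b'‖ ≤ K₀ * Real.exp (-(kap * tdist1 Nf (locΛ b) (locΛ b'))))
    (hCE : ∀ b b', ‖(C⁻¹.map (algebraMap ℝ ℂ)) b b'‖ ≤ KE * Real.exp (-(kap * tdist1 Nf (locΛ b) (locΛ b'))))
    (hdΓ : ∀ σ : TPt d N' → ℂ, (∀ j, σ j ∈ Uσ) →
      ∀ b j, ‖(G σ - Γ₀.map (algebraMap ℝ ℂ)) b j‖ ≤ θΓ * Real.exp (-(kap * tdist1 Nf (locΛ b) (locN j))))
    (hdC : ∀ σ : TPt d N' → ℂ, (∀ j, σ j ∈ Uσ) →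
      ∀ b b', ‖((A σ)⁻¹ - C.map (algebraMap ℝ ℂ)) b b'‖
        ≤ θC * Real.exp (-(kap * tdist1 Nf (locΛ b) (locΛ b'))))
    (hdE : ∀ σ : TPt d N' → ℂ, (∀ j, σ j ∈ Uσ) →
      ∀ b b', ‖(A σ - C⁻¹.map (algebraMap ℝ ℂ)) b b'‖ ≤ θE * Real.exp (-(kap * tdist1 Nf (locΛ b) (locΛ b'))))
    {ρb KG' KCs' θΓ' θC' θE' : ℝ} (hρb1 : ρb < 1)
    (hKG' : (1 + ρb) * KG ≤ KG') (hKCs' : ((1 - ρb) ^ 2)⁻¹ * KCs ≤ KCs')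
    (hθΓ' : θΓ + ρb * KG ≤ θΓ') (hθC' : θC + ρb * (2 + ρb) * ((1 - ρb) ^ 2)⁻¹ * KCs ≤ θC')
    (hθE' : θE + ρb * (2 + ρb) * (θE + KE) ≤ θE')
    (hθEle : θE' ≤ θ) (hθΓle : θΓ' ≤ θ)
    (hθR1le : (m * (1 + 2 / (kap - kap')) ^ ν) * (m * (1 + 2 / (kap' - kap'')) ^ ν)
      * (θΓ' * KCs' * KG' + KΓ * θC' * KG' + KΓ * K₀ * θΓ') ≤ θ)
    (hsmallKθ : K₀ * (m * (1 + 2 / kap) ^ ν) * (θ * (m * (1 + 2 / kap'') ^ ν)) < 1)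
    {cE g : ℝ} (hc0 : 0 ≤ cE) (hc : ∀ k, hC.1.eigenvalues k ≤ cE) {α₀ : ℝ} (hα₀ : 0 ≤ α₀)
    (hαc : (2 * (θ * (m * (1 + 2 / kap'') ^ ν)) + α₀) * cE ≤ 1 / 2)
    (hΓq : ∀ X : Λ ⊕ C₀ → ℝ, (Γ₀ *ᵥ X) ⬝ᵥ (C *ᵥ (Γ₀ *ᵥ X)) ≤ g * (X ⬝ᵥ X))
    (hsmall : (2 * (θ * (m * (1 + 2 / kap'') ^ ν)) + α₀) * (1 + 2 * cE * g) ≤ 1 / 2) :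
    ∀ b ∈ ball (1 : ℂ) ρb,
      term214 r lZ lD (core214 (fun σ => b ^ 2 • A σ) (fun σ X => b • Γ σ X)
          (F214 cardP (fun _ => 1) (fun _ => 1) Dfam (fun Y _ => O₀ Y))) 0 0
        = term214 r lZ lD (core214 A Γ (F214 cardP (fun _ => 1) (fun _ => 1) Dfam (fun Y _ => O₀ Y))) 0 0 := by
  have hBB : ∀ B : Λ → ℝ, 0 ≤ B ⬝ᵥ B := fun B => Finset.sum_nonneg fun i _ => mul_self_nonneg (B i)
  -- (2.22) for the box-free data at radius 0 and rate α₀; the (2.20) shape of the field-constant potentials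
  have h11 : ∀ B : Λ → ℝ, (fun _ : Λ → ℝ => (1 : ℝ)) B * (fun _ : Λ → ℝ => (1 : ℝ)) B ≤ 1 := fun B => by norm_num
  have h222 : ∀ B : Λ → ℝ, (fun _ : Λ → ℝ => (1 : ℝ)) B * (fun _ : Λ → ℝ => (1 : ℝ)) B
      ≤ Real.exp (-(α₀ / 2 * (0 : ℝ) ^ 2 * cardP) + α₀ / 2 * (B ⬝ᵥ B)) := fun B =>
    chi_le_h222_zero_radius h11 hα₀ cardP B
  have h220U : ∀ τ : TDom d (L * N') → ℂ, (∀ Y, τ Y ∈ Uτ Y) → ∀ B : Λ → ℝ,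
      ∑ Y ∈ Dfam, ‖τ Y‖ * (‖(fun (_ : TDom d (L * N')) (_ : Λ → ℝ) => (0 : ℂ)) Y B‖ + ‖(fun Y (_ : Λ → ℝ) => O₀ Y) Y B‖)
        ≤ 0 / 2 * (B ⬝ᵥ B) + w₀ := fun τ hτ B => by
    simp only [norm_zero, zero_add, zero_div, zero_mul]
    exact hw₀U τ hτ
  -- holomorphy in `b` on the ball (module 41 §4 at χ := 1, W := 0, O := O₀)
  have hhol := differentiableOn_term214_torus_windowDilated_of_primitives c hUσ hUτ hUexp hr hr' hsubτ hlZ hlD A Γ cardP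
    (fun _ => (1 : ℝ)) (fun _ => (1 : ℝ)) (fun _ => zero_le_one) (fun _ => zero_le_one) Dfam
    (fun _ _ => (0 : ℂ)) (fun Y _ => O₀ Y) hC Γ₀ hAhol measurable_const measurable_const (fun _ => measurable_const)
    (fun _ => measurable_const) hAs G hGhol hlin (γ₂ := α₀) (rP := 0) (a₂₀ := 0) (w := w₀) (fun B => B ⬝ᵥ B) h222 hα₀
    (fun _ => le_rfl) le_rfl h220U locΛ locN hfibΛ hfibN hkap'' hk1 hk2 hθE hθΓ hθC hKG hKΓ hKCs hK₀ hKE hG hΓ₀ hCs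
    hC216 hCE hdΓ hdC hdE hρb1 hKG' hKCs' hθΓ' hθC' hθE' (a' := 0) (w' := (1 + ρb) ^ 2 * w₀) (by simp) le_rfl hθEle
    hθΓle hθR1le hsmallKθ hc0 hc (by simpa only [add_zero] using hαc) hΓq (by simpa only [add_zero] using hsmall)
  have hhol' : DifferentiableOn ℂ (fun b : ℂ => term214 r lZ lD (core214 (fun σ => b ^ 2 • A σ) (fun σ X => b • Γ σ X)
      (F214 cardP (fun _ => 1) (fun _ => 1) Dfam (fun Y _ => O₀ Y))) 0 0) (ball (1 : ℂ) ρb) := by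
    refine hhol.congr fun b _ => ?_
    simp only [mul_zero, zero_add]
  -- radial invariance (the field-constant last line is blind to `B ↦ r⁻¹B`)
  have hrad : ∀ r' : ℝ, r' ≠ 0 → ∀ b : ℂ,
      term214 r lZ lD (core214 (fun σ => ((r' : ℂ) * b) ^ 2 • A σ) (fun σ X => ((r' : ℂ) * b) • Γ σ X)
          (F214 cardP (fun _ => 1) (fun _ => 1) Dfam (fun Y _ => O₀ Y))) 0 0
        = term214 r lZ lD (core214 (fun σ => b ^ 2 • A σ) (fun σ X => b • Γ σ X)
          (F214 cardP (fun _ => 1) (fun _ => 1) Dfam (fun Y _ => O₀ Y))) 0 0 := fun r' hr0 b => by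
    rw [term214_dilate_family r lZ lD A Γ _ hr0 b 0 0]
    rfl
  have key := eq_of_radial_invariant (f := fun b : ℂ => term214 r lZ lD (core214 (fun σ => b ^ 2 • A σ)
    (fun σ X => b • Γ σ X) (F214 cardP (fun _ => 1) (fun _ => 1) Dfam (fun Y _ => O₀ Y))) 0 0) hρb1.le hhol' hrad
  intro b hb
  have h := key b hb
  simpa only [one_pow, one_smul] using h

/-! ## §4. The large-field members (`P ≠ ∅`): the (2.22) surplus in front of the (2.26) weight at a smaller radius -/

open Classical in
/-- **THE LARGE-FIELD MEMBERS ALONG THE WINDOW-DILATED FAMILY ARE SMALL: the (2.22) surplus `e^{−½γ₂(r_P² − r′²)}` comes out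
in front of the (2.26) weight at the smaller radius `r′`** (lens Card T24 (ii) at term level; node N22's (S-vertex-T′) for
terms with `P ≠ ∅`, whose centre is `0`).  Data and letters of `B13Term214WindowDilated.h226_torus_windowDilated_of_primitives`
VERBATIM, plus a radius `r′` with `r′² ≤ r_P²`, `|P| ≥ 1`, and the weight's `|P|`-rate at `r′` (`hPa : a ≤ γ₂r′²`).  Proof:
homogeneity — `F214(χ, χᶜ, 𝐕) = c·F214(χ∕c, χᶜ, 𝐕)` with `c := e^{−½γ₂(r_P² − r′²)}` (`F214_chi_const_mul`), the constant
passes the `X`-integral and the printed operators with NO hypothesis (`core214_const_mul`, `term214_const_mul`), the rescaled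
data obey (2.22) at radius `r′` (`h222_rate_split`), and module 41 §4 prices the rest.  No new engine.
[cite: Balaban1988RG2Cluster, (2.14)–(2.15) p.15, (2.16)–(2.22) p.16, (2.23)–(2.26) p.17; Balaban1987RG1, (2.10)-(2.12) p.267] -/
theorem h226_torus_windowDilated_largeField_of_primitives (c : B13.Consts) (hκ₁ : 1 ≤ c.κ₁) (hα₆ : c.α₆ ≠ 0)
    (Z : TDom d N') (t : Finset (TDom d (L * N')) × Finset (TBond d M (L * N')))
    (hpos : ∀ Y : TDom d (L * N'), 0 < invTau c ((tsys d (L * N')).dj Y))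
    (hhalf : ∀ Y : TDom d (L * N'), invTau c ((tsys d (L * N')).dj Y) ≤ 1 / 2)
    {Uσ : Set ℂ} {Uτ : TDom d (L * N') → Set ℂ} (hUσ : IsOpen Uσ) (hUτ : ∀ Y, IsOpen (Uτ Y))
    (hUexp : closedBall (0 : ℂ) (Real.exp c.κ₁) ⊆ Uσ)
    (hUtau : ∀ Y : TDom d (L * N'), closedBall (0 : ℂ) ((invTau c ((tsys d (L * N')).dj Y))⁻¹) ⊆ Uτ Y)
    {r : ℝ} (hr : 0 < r) (hr' : r ≤ Real.exp c.κ₁ - 1)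
    (hsubτ : ∀ Y, ∀ s ∈ Set.uIcc (0 : ℝ) 1, closedBall (s : ℂ) r ⊆ Uτ Y)
    (lZ : List (TPt d N')) (hlZ : lZ.Nodup ∧ lZ.toFinset = Z.1 \ tclosure L N' (Z0 M t))
    (lD : List (TDom d (L * N'))) (hlD : lD.Nodup ∧ lD.toFinset = t.1)
    (A : (TPt d N' → ℂ) → Matrix Λ Λ ℂ) (Γ : (TPt d N' → ℂ) → (Λ ⊕ C₀ → ℝ) → (Λ → ℂ))
    (χY₀ χcP : (Λ → ℝ) → ℝ) (hχ0 : ∀ B, 0 ≤ χY₀ B) (hχc0 : ∀ B, 0 ≤ χcP B) (Dfam : Finset (TDom d (L * N')))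
    (W O : TDom d (L * N') → (Λ → ℝ) → ℂ)
    {C : Matrix Λ Λ ℝ} (hC : C.PosDef) (Γ₀ : Matrix Λ (Λ ⊕ C₀) ℝ)
    (hAhol : ∀ i j, DifferentiableOn ℂ (fun σ => A σ i j) {σ | ∀ j, σ j ∈ Uσ})
    (hχm : Measurable χY₀) (hχcm : Measurable χcP) (hWm : ∀ Y, Measurable (W Y)) (hOm : ∀ Y, Measurable (O Y))
    (hAs : ∀ σ : TPt d N' → ℂ, (∀ j, σ j ∈ Uσ) → (A σ).IsSymm)
    (G : (TPt d N' → ℂ) → Matrix Λ (Λ ⊕ C₀) ℂ)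
    (hGhol : ∀ i j, DifferentiableOn ℂ (fun σ => G σ i j) {σ | ∀ j, σ j ∈ Uσ})
    (hlin : ∀ σ : TPt d N' → ℂ, (∀ j, σ j ∈ Uσ) → ∀ X : Λ ⊕ C₀ → ℝ, Γ σ X = G σ *ᵥ fun j => (X j : ℂ))
    -- (2.22) at radius r_P with |P| ≥ 1, a smaller radius r′; the joint (2.20) shape of |W| + |O|
    {γ₂ rP r₁ a₂₀ w : ℝ} (qP : (Λ → ℝ) → ℝ)
    (h222 : ∀ B, χY₀ B * χcP B ≤ Real.exp (-(γ₂ / 2 * rP ^ 2 * (t.2.card : ℕ)) + γ₂ / 2 * qP B)) (hγ₂ : 0 ≤ γ₂)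
    (hqP : ∀ B, qP B ≤ B ⬝ᵥ B) (hr₁ : r₁ ^ 2 ≤ rP ^ 2) (hP1 : 1 ≤ t.2.card) (ha0 : 0 ≤ a₂₀)
    (h220U : ∀ τ : TDom d (L * N') → ℂ, (∀ Y, τ Y ∈ Uτ Y) →
      ∀ B, ∑ Y ∈ Dfam, ‖τ Y‖ * (‖W Y B‖ + ‖O Y B‖) ≤ a₂₀ / 2 * (B ⬝ᵥ B) + w)
    (locΛ : Λ → UT Nf) (locN : Λ ⊕ C₀ → UT Nf) {m : ℕ}
    (hfibΛ : ∀ x : UT Nf, (Finset.univ.filter fun i => locΛ i = x).card ≤ m)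
    (hfibN : ∀ x : UT Nf, (Finset.univ.filter fun j => locN j = x).card ≤ m)
    {kap kap' kap'' θ θE θΓ θC KG KΓ KCs K₀ KE : ℝ} (hkap'' : 0 < kap'') (h1 : kap'' < kap') (h2 : kap' < kap)
    (hθE : 0 ≤ θE) (hθΓ : 0 ≤ θΓ) (hθC : 0 ≤ θC) (hKG : 0 ≤ KG) (hKΓ : 0 ≤ KΓ) (hKCs : 0 ≤ KCs) (hK₀ : 0 ≤ K₀)
    (hKE : 0 ≤ KE)
    (hG : ∀ σ : TPt d N' → ℂ, (∀ j, σ j ∈ Uσ) →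
      ∀ b j, ‖G σ b j‖ ≤ KG * Real.exp (-(kap * tdist1 Nf (locΛ b) (locN j))))
    (hΓ₀ : ∀ b j, ‖Γ₀ b j‖ ≤ KΓ * Real.exp (-(kap * tdist1 Nf (locΛ b) (locN j))))
    (hCs : ∀ σ : TPt d N' → ℂ, (∀ j, σ j ∈ Uσ) →
      ∀ b b', ‖(A σ)⁻¹ b b'‖ ≤ KCs * Real.exp (-(kap * tdist1 Nf (locΛ b) (locΛ b'))))
    (hC216 : ∀ b b', ‖C b b'‖ ≤ K₀ * Real.exp (-(kap * tdist1 Nf (locΛ b) (locΛ b'))))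
    (hCE : ∀ b b', ‖(C⁻¹.map (algebraMap ℝ ℂ)) b b'‖ ≤ KE * Real.exp (-(kap * tdist1 Nf (locΛ b) (locΛ b'))))
    (hdΓ : ∀ σ : TPt d N' → ℂ, (∀ j, σ j ∈ Uσ) →
      ∀ b j, ‖(G σ - Γ₀.map (algebraMap ℝ ℂ)) b j‖ ≤ θΓ * Real.exp (-(kap * tdist1 Nf (locΛ b) (locN j))))
    (hdC : ∀ σ : TPt d N' → ℂ, (∀ j, σ j ∈ Uσ) →
      ∀ b b', ‖((A σ)⁻¹ - C.map (algebraMap ℝ ℂ)) b b'‖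
        ≤ θC * Real.exp (-(kap * tdist1 Nf (locΛ b) (locΛ b'))))
    (hdE : ∀ σ : TPt d N' → ℂ, (∀ j, σ j ∈ Uσ) →
      ∀ b b', ‖(A σ - C⁻¹.map (algebraMap ℝ ℂ)) b b'‖ ≤ θE * Real.exp (-(kap * tdist1 Nf (locΛ b) (locΛ b'))))
    {ρb KG' KCs' θΓ' θC' θE' a' w' : ℝ} (hρb1 : ρb < 1)
    (hKG' : (1 + ρb) * KG ≤ KG') (hKCs' : ((1 - ρb) ^ 2)⁻¹ * KCs ≤ KCs')
    (hθΓ' : θΓ + ρb * KG ≤ θΓ') (hθC' : θC + ρb * (2 + ρb) * ((1 - ρb) ^ 2)⁻¹ * KCs ≤ θC')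
    (hθE' : θE + ρb * (2 + ρb) * (θE + KE) ≤ θE')
    (ha' : (1 + ρb) ^ 2 * a₂₀ ≤ a') (hw' : (1 + ρb) ^ 2 * w ≤ w')
    (hθEle : θE' ≤ θ) (hθΓle : θΓ' ≤ θ)
    (hθR1le : (m * (1 + 2 / (kap - kap')) ^ ν) * (m * (1 + 2 / (kap' - kap'')) ^ ν)
      * (θΓ' * KCs' * KG' + KΓ * θC' * KG' + KΓ * K₀ * θΓ') ≤ θ)
    (hsmallKθ : K₀ * (m * (1 + 2 / kap) ^ ν) * (θ * (m * (1 + 2 / kap'') ^ ν)) < 1)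
    {cE g : ℝ} (hc0 : 0 ≤ cE) (hc : ∀ k, hC.1.eigenvalues k ≤ cE)
    (hαc : (2 * (θ * (m * (1 + 2 / kap'') ^ ν)) + (γ₂ + a')) * cE ≤ 1 / 2) (hg : 0 ≤ g)
    (hΓq : ∀ X : Λ ⊕ C₀ → ℝ, (Γ₀ *ᵥ X) ⬝ᵥ (C *ᵥ (Γ₀ *ᵥ X)) ≤ g * (X ⬝ᵥ X))
    (hsmall : (2 * (θ * (m * (1 + 2 / kap'') ^ ν)) + (γ₂ + a')) * (1 + 2 * cE * g) ≤ 1 / 2)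
    -- constant matching at the SMALLER radius r₁
    {a a₅ : ℝ} (hPa : a ≤ γ₂ * r₁ ^ 2)
    (hvol : 2 * (K₀ * (m * (1 + 2 / kap) ^ ν) * (θ * (m * (1 + 2 / kap'') ^ ν))
              * (1 + (1 - K₀ * (m * (1 + 2 / kap) ^ ν) * (θ * (m * (1 + 2 / kap'') ^ ν)))⁻¹) / 2)
          * (Fintype.card Λ : ℝ)
        + w' + (2 * (θ * (m * (1 + 2 / kap'') ^ ν)) + (γ₂ + a')) * cE * (Fintype.card Λ : ℝ)
        + (2 * (θ * (m * (1 + 2 / kap'') ^ ν)) + (γ₂ + a')) * (1 + 2 * cE * g) * (Fintype.card (Λ ⊕ C₀) : ℝ)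
        ≤ a₅ * ((Z.1).card : ℝ))
    {b : ℂ} (hb : b ∈ ball (1 : ℂ) ρb) :
    ‖term214 r lZ lD (core214 (fun σ => b ^ 2 • A σ) (fun σ X => b • Γ σ X)
        (F214 t.2.card χY₀ χcP Dfam (fun Y B => b ^ 2 * W Y B + O Y B))) 0 0‖ ≤
      Real.exp (-(γ₂ / 2 * (rP ^ 2 - r₁ ^ 2))) * (weight L M c Z a t * Real.exp (a₅ * ((Z.1).card : ℝ))) := by
  set cP : ℝ := Real.exp (-(γ₂ / 2 * (rP ^ 2 - r₁ ^ 2))) with hcP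
  have hcP0 : 0 < cP := Real.exp_pos _
  -- homogeneity: the surplus comes out of the last line, the X-integral and the printed operators
  have hχeq : (fun B => cP * (χY₀ B / cP)) = χY₀ := funext fun B => mul_div_cancel₀ (χY₀ B) hcP0.ne'
  have hcore : ∀ σ τ, core214 (fun σ => b ^ 2 • A σ) (fun σ X => b • Γ σ X)
        (F214 t.2.card χY₀ χcP Dfam (fun Y B => b ^ 2 * W Y B + O Y B)) σ τ
      = (cP : ℂ) * core214 (fun σ => b ^ 2 • A σ) (fun σ X => b • Γ σ X)
        (F214 t.2.card (fun B => χY₀ B / cP) χcP Dfam (fun Y B => b ^ 2 * W Y B + O Y B)) σ τ := by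
    intro σ τ
    rw [← core214_const_mul]
    congr 1
    funext τ B
    rw [← F214_chi_const_mul, hχeq]
  have hterm : term214 r lZ lD (core214 (fun σ => b ^ 2 • A σ) (fun σ X => b • Γ σ X)
        (F214 t.2.card χY₀ χcP Dfam (fun Y B => b ^ 2 * W Y B + O Y B))) 0 0
      = (cP : ℂ) * term214 r lZ lD (core214 (fun σ => b ^ 2 • A σ) (fun σ X => b • Γ σ X)
        (F214 t.2.card (fun B => χY₀ B / cP) χcP Dfam (fun Y B => b ^ 2 * W Y B + O Y B))) 0 0 := by
    rw [← term214_const_mul]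
    congr 1
    funext σ τ
    exact hcore σ τ
  -- the rescaled characteristic functions obey (2.22) at radius r₁
  have h222' : ∀ B, χY₀ B / cP * χcP B ≤ Real.exp (-(γ₂ / 2 * r₁ ^ 2 * (t.2.card : ℕ)) + γ₂ / 2 * qP B) := fun B => by
    rw [div_mul_eq_mul_div]
    exact h222_rate_split hγ₂ hr₁ hP1 (h222 B)
  have hχ0' : ∀ B, 0 ≤ χY₀ B / cP := fun B => div_nonneg (hχ0 B) hcP0.le
  have h226 := h226_torus_windowDilated_of_primitives c hκ₁ hα₆ Z t hpos hhalf hUσ hUτ hUexp hUtau hr hr' hsubτ lZ hlZ lD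
    hlD A Γ (fun B => χY₀ B / cP) χcP hχ0' hχc0 Dfam W O hC Γ₀ hAhol (hχm.div_const _) hχcm hWm hOm hAs G hGhol hlin qP
    h222' hγ₂ hqP ha0 h220U locΛ locN hfibΛ hfibN hkap'' h1 h2 hθE hθΓ hθC hKG hKΓ hKCs hK₀ hKE hG hΓ₀ hCs hC216 hCE hdΓ
    hdC hdE hρb1 hKG' hKCs' hθΓ' hθC' hθE' ha' hw' hθEle hθΓle hθR1le hsmallKθ hc0 hc hαc hg hΓq hsmall hPa hvol b hb
  rw [hterm, norm_mul, Complex.norm_real, Real.norm_of_nonneg hcP0.le]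
  exact mul_le_mul_of_nonneg_left h226 hcP0.le

end Torus

end Literature.MathematicalPhysics.QuantumFieldTheory.Balaban1983to89.B13Bound226BoxTail

end
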